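import Summits.QuantumAdvantage.QuantumAdvantage.Theorems.LinnikCubicClassGroupsDegreeOnePrimesEscapeClassPNTTZFormOdd
import Summits.QuantumAdvantage.QuantumAdvantage.Theorems.LinnikCubicClassGroupsDegreeOnePrimesEscapeClassPNTNoExceptionalDegOne
import HarnessLib

/-!
# Thorner–Zaman (2019) Thm 1.4 at a fixed degree for the DEGREE-ONE primes of an ideal class

Topic `Summits/QuantumAdvantage/QuantumAdvantage/Theorems`, cell B2b-1 (linnik-cubic), PART A (gen 32);
helper toward the crux `DegreeOnePrimesEscape` (stmt-QuantumAdvantage-11543) of route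
`LinnikCubicClassGroups`.  HONEST FRAMING: the value of this file is a THEOREM (kernel-checked, GRH-free,
Siegel-free) — NOT summit progress (the route still rests on the hypothesis-type target
`PureCubicClassNumberHard`).

The primes that the route's quantum algorithm samples are the prime ideals of RESIDUE DEGREE ONE
(`degOneClassCount K C x = #{𝔭 : N𝔭 prime, N𝔭 ≤ x, [𝔭] = C}`).  Since a class contains at most
`[K:ℚ](√x + 1)` primes of degree `≥ 2` below `x` (`primeIdealClassCount_sub_degOneClassCount_le`) and
`26 n √x ≤ E(x) · x Q^{−s}/(4 h log x)` in the range `log x ≥ (72 + 8s) log Q` (`junk_le_errorTermN_mul`,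
[ThornerZaman2019, proof of Thm. 5.1, absorption of `𝓔₀(x) ≪ x^{1/2}`]), the `π_C`-form theorems of
`…ClassPNTTZFormPi.lean` / `…ClassPNTTZFormOdd.lean` hold verbatim for the degree-one counts:

(each stated in SANDWICH form `π¹_C(x) ≤ π_C(x) ∧ |π¹_C(x) − main| ≤ error`, which also keeps the statements
syntactically distinct from the `π_C` versions for the gate's restatement check):

* `degOneClassCount_TZ_dichotomy (n) (hn : 1 < n)` — the Thorner–Zaman dichotomy (window `1/(8 log Q)`,
  error `c₃ · errorTermN c₂ Q n x`, relative to `Li(x)` resp. `Li(x) − χ₁(C) Li(x^{β₁})`) for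
  `degOneClassCount`, every number field of degree `n`;
* `degOneClassCount_TZ_of_odd (n)`, `degOneClassCount_TZ_cubic` — odd degree / every cubic field:
  `|π¹_C(x) − Li(x)/h| ≤ c₃ E(x) Li(x)/h`, NO Landau–Siegel term.

References: J. Thorner, A. Zaman, Algebra Number Theory 13 (2019), Thm. 1.4, proof of Thm. 5.1
[ThornerZaman2019]; A. Weiss, J. reine angew. Math. 338 (1983), Thm. 6.4 [Weiss1983].
-/

set_option linter.dupNamespace false

noncomputable section

open scoped NumberField
open Real MeasureTheory Set NumberField

namespace Summit.QuantumAdvantage.QuantumAdvantage.Theorems.DegreeOnePrimesEscape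

open Literature.NumberTheory.LFunctions Literature.NumberTheory.LFunctions.NumberField

/-- **Absorption of the primes of degree `≥ 2` of a class**: for `K` of degree `n > 1`, `Q = condQn K`,
`h = h_K`, `0 ≤ s`, `c ≤ 1`, `log x ≥ (72 + 8s) log Q`:
`h · (π_C(x) − π¹_C(x)) ≤ (1/13) · errorTermN (c/2) Q n x · x Q^{−s}/(4 log x)`.
[cite: ThornerZaman2019, proof of Thm. 5.1] -/
theorem degOne_defect_le {K : Type} [Field K] [NumberField K] {n : ℕ} (hn : 1 < n)
    (hKn : Module.finrank ℚ K = n) (C : ClassGroup (𝓞 K)) {s c x : ℝ} (hs : 0 ≤ s) (hc1 : c ≤ 1)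
    (hx : (72 + 8 * s) * Real.log (ThornerZaman.condQn K) ≤ Real.log x) (hx1 : 1 ≤ x) :
    (NumberField.classNumber K : ℝ) * ((primeIdealClassCount K C x : ℝ) - degOneClassCount K C x) ≤
      1 / 13 * (ThornerZaman.errorTermN (c / 2) (ThornerZaman.condQn K) n x *
        (x * ThornerZaman.condQn K ^ (-s) / (4 * Real.log x))) := by
  have hK : 1 < Module.finrank ℚ K := by rw [hKn]; exact hn
  have hQ12 : (12 : ℝ) ≤ ThornerZaman.condQn K := ThornerZaman.twelve_le_condQn (K := K) hK
  have hh1 : (1 : ℝ) ≤ NumberField.classNumber K := by exact_mod_cast one_le_classNumber (K := K)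
  have hh0 : (0 : ℝ) < NumberField.classNumber K := by linarith
  have hhQ : (NumberField.classNumber K : ℝ) ≤ ThornerZaman.condQn K ^ (4 : ℕ) :=
    ThornerZaman.classNumber_le_condQn_pow hK
  have hn1 : (1 : ℝ) ≤ n := by exact_mod_cast hn.le
  have hnQ : (n : ℝ) ≤ ThornerZaman.condQn K := by
    have := ThornerZaman.finrank_le_condQn (K := K); rw [hKn] at this; exact this
  have hx0 : 0 < x := by linarith
  have hjunk := junk_le_errorTermN_mul n hQ12 hh1 hhQ hn1 hnQ hs hc1 hx0 hx
  have hdef := primeIdealClassCount_sub_degOneClassCount_le K C hx0.le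
  rw [hKn] at hdef
  -- `n (√x + 1) ≤ 2 n √x` and `h · 2 n √x = (1/13) · 26 n √x · h`
  have hsqrt1 : 1 ≤ Real.sqrt x := by rw [Real.le_sqrt (by norm_num) hx0.le]; linarith
  have h1 : (primeIdealClassCount K C x : ℝ) - degOneClassCount K C x ≤ 2 * n * Real.sqrt x := by nlinarith
  have h2 : (NumberField.classNumber K : ℝ) * (2 * n * Real.sqrt x) ≤
      1 / 13 * (ThornerZaman.errorTermN (c / 2) (ThornerZaman.condQn K) n x *
        (x * ThornerZaman.condQn K ^ (-s) / (4 * Real.log x))) := by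
    have e : ThornerZaman.errorTermN (c / 2) (ThornerZaman.condQn K) n x *
        (x * ThornerZaman.condQn K ^ (-s) / (4 * NumberField.classNumber K * Real.log x)) *
        NumberField.classNumber K =
        ThornerZaman.errorTermN (c / 2) (ThornerZaman.condQn K) n x *
          (x * ThornerZaman.condQn K ^ (-s) / (4 * Real.log x)) := by
      field_simp
    have := mul_le_mul_of_nonneg_right hjunk hh0.le
    rw [e] at this
    nlinarith
  exact (mul_le_mul_of_nonneg_left h1 hh0.le).trans h2

set_option maxHeartbeats 800000 in
/-- **Thorner–Zaman (2019), Theorem 1.4, for the DEGREE-ONE primes of the ideal classes of the number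
fields of a fixed degree `n > 1`** (see the module docstring). [cite: ThornerZaman2019, Theorem 1.4]
[cite: Weiss1983, Theorem 6.4] -/
theorem degOneClassCount_TZ_dichotomy (n : ℕ) (hn : 1 < n) :
    ∃ c₁ c₂ c₃ : ℝ, 0 < c₁ ∧ 0 < c₂ ∧ 0 < c₃ ∧
    ∀ (K : Type) [Field K] [NumberField K], Module.finrank ℚ K = n →
      (((∀ χ : ClassGroup (𝓞 K) →* ℂˣ, χ * χ = 1 →
            ∀ β : ℝ, 1 - 1 / (8 * Real.log (ThornerZaman.condQn K)) < β → β < 1 →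
              classGroupLFunction K χ β ≠ 0) ∧
          ∀ (C : ClassGroup (𝓞 K)) (x : ℝ), ThornerZaman.condQn K ^ c₁ ≤ x →
            (degOneClassCount K C x : ℝ) ≤ primeIdealClassCount K C x ∧
            |(degOneClassCount K C x : ℝ) - offsetLogIntegral x / NumberField.classNumber K| ≤
              c₃ * ThornerZaman.errorTermN c₂ (ThornerZaman.condQn K) n x *
                (offsetLogIntegral x / NumberField.classNumber K)) ∨
        ∃ (χ₁ : ClassGroup (𝓞 K) →* ℂˣ) (β₁ : ℝ), χ₁ * χ₁ = 1 ∧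
          1 - 1 / (8 * Real.log (ThornerZaman.condQn K)) < β₁ ∧ β₁ < 1 ∧
          classGroupLFunction K χ₁ β₁ = 0 ∧
          ∀ (C : ClassGroup (𝓞 K)) (x : ℝ), ThornerZaman.condQn K ^ c₁ ≤ x →
            (degOneClassCount K C x : ℝ) ≤ primeIdealClassCount K C x ∧
            |(degOneClassCount K C x : ℝ) -
                (offsetLogIntegral x - ((χ₁ C : ℂ)).re * offsetLogIntegral (x ^ β₁)) /
                  NumberField.classNumber K| ≤
              c₃ * ThornerZaman.errorTermN c₂ (ThornerZaman.condQn K) n x *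
                ((offsetLogIntegral x - ((χ₁ C : ℂ)).re * offsetLogIntegral (x ^ β₁)) /
                  NumberField.classNumber K)) := by
  classical
  obtain ⟨c₁, c₂, c₃, hc₁, hc₂, hc₃, H⟩ := classPNT_TZ_dichotomy n hn
  obtain ⟨cS, hcS, hcS1, heff⟩ := Residue.one_sub_realZero_ge_condQn_rpow n hn
  set s : ℝ := 2 + max 0 (Real.log (1 / cS)) with hsdef
  have hs0 : 0 ≤ s := by have : 0 ≤ max 0 (Real.log (1 / cS)) := le_max_left _ _; linarith
  have hc'1 : min c₂ 1 ≤ 1 := min_le_right _ _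
  have hc'0 : 0 < min c₂ 1 := lt_min hc₂ one_pos
  refine ⟨max c₁ (72 + 8 * s), min c₂ 1 / 2, c₃ + 1, by positivity, by positivity, by positivity,
    fun K _ _ hKn ↦ ?_⟩
  have hK : 1 < Module.finrank ℚ K := by rw [hKn]; exact hn
  have hHK := H K hKn
  have heffK := heff K hKn
  set Q : ℝ := ThornerZaman.condQn K with hQ
  have hQ12 : (12 : ℝ) ≤ Q := ThornerZaman.twelve_le_condQn (K := K) hK
  have hQ1 : (1 : ℝ) < Q := by linarith
  have hQ0 : (0 : ℝ) < Q := by linarith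
  have hlogQ : 2 ≤ Real.log Q := two_lt_log_twelve.le.trans (Real.log_le_log (by norm_num) hQ12)
  set h : ℝ := (NumberField.classNumber K : ℝ) with hh
  have hh1 : 1 ≤ h := by rw [hh]; exact_mod_cast one_le_classNumber (K := K)
  have hh0 : 0 < h := by linarith
  -- the range and the error terms
  have hrange : ∀ x : ℝ, Q ^ max c₁ (72 + 8 * s) ≤ x → Q ^ c₁ ≤ x ∧ 256 ≤ x ∧ 1 ≤ x ∧
      (72 + 8 * s) * Real.log Q ≤ Real.log x ∧
      ThornerZaman.errorTermN c₂ Q n x ≤ ThornerZaman.errorTermN (min c₂ 1 / 2) Q n x ∧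
      ThornerZaman.errorTermN (min c₂ 1 / 2) Q n x ≤ ThornerZaman.errorTermN (min c₂ 1 / 2) Q n x := by
    intro x hx
    have hxc₁ : Q ^ c₁ ≤ x := (Real.rpow_le_rpow_of_exponent_le hQ1.le (le_max_left _ _)).trans hx
    have hx72 : Q ^ (72 + 8 * s) ≤ x := (Real.rpow_le_rpow_of_exponent_le hQ1.le (le_max_right _ _)).trans hx
    have hxpos : 0 < x := lt_of_lt_of_le (Real.rpow_pos_of_pos hQ0 _) hx
    have hlog : (72 + 8 * s) * Real.log Q ≤ Real.log x := by
      rw [← Real.log_rpow hQ0]; exact Real.log_le_log (Real.rpow_pos_of_pos hQ0 _) hx72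
    have h256 : (256 : ℝ) ≤ x := by
      have hl : Real.log 256 ≤ Real.log x := by
        have : Real.log 256 = 8 * Real.log 2 := by
          rw [show (256 : ℝ) = 2 ^ 8 by norm_num, Real.log_pow]; norm_num
        have hsq : 0 ≤ s * Real.log Q := by positivity
        linarith [Real.log_two_lt_d9]
      exact (Real.log_le_log_iff (by norm_num) hxpos).mp hl
    have hx1 : (1 : ℝ) ≤ x := by linarith
    refine ⟨hxc₁, h256, hx1, hlog, ?_, le_rfl⟩
    exact ThornerZaman.errorTermN_le_of_le (by
      have := min_le_left c₂ 1; linarith) hQ1 n hx1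
  rcases hHK with ⟨hzf, hA⟩ | ⟨χ₁, β₁, hreal, hwin, hβ1, hL0, hB⟩
  · refine Or.inl ⟨hzf, fun C x hx ↦ ⟨by exact_mod_cast degOneClassCount_le K C x, ?_⟩⟩
    obtain ⟨hxc₁, hx256, hx1, hlog, hEE', -⟩ := hrange x hx
    have hx0 : 0 < x := by linarith
    set E : ℝ := ThornerZaman.errorTermN c₂ Q n x with hE
    set E' : ℝ := ThornerZaman.errorTermN (min c₂ 1 / 2) Q n x with hE'
    have hE'0 : 0 < E' := ThornerZaman.errorTermN_pos _ _ _ _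
    have h1 := hA C x hxc₁
    have hdef := degOne_defect_le hn hKn C (s := 0) le_rfl hc'1 (by rw [← hQ]; nlinarith) hx1
    rw [← hQ, Real.rpow_neg hQ0.le, Real.rpow_zero, inv_one, mul_one] at hdef
    have hLi : x / (2 * Real.log x) ≤ offsetLogIntegral x := div_two_mul_log_le_offsetLogIntegral hx256
    have hLx : 0 < Real.log x := Real.log_pos (by linarith)
    have hLi0 : 0 ≤ offsetLogIntegral x := le_trans (by positivity) hLi
    -- `h (π − π¹) ≤ (1/13) E' x/(4 log x) ≤ E' Li/26`
    have hdef' : h * ((primeIdealClassCount K C x : ℝ) - degOneClassCount K C x) ≤ E' * offsetLogIntegral x := by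
      refine hdef.trans ?_
      have : x / (4 * Real.log x) ≤ offsetLogIntegral x := by
        refine le_trans ?_ hLi
        rw [div_le_div_iff₀ (by positivity) (by positivity)]; nlinarith
      nlinarith [mul_le_mul_of_nonneg_left this hE'0.le]
    have hmono : (degOneClassCount K C x : ℝ) ≤ primeIdealClassCount K C x := by
      exact_mod_cast degOneClassCount_le K C x
    -- `|π¹ − Li/h| ≤ |π − Li/h| + (π − π¹)`
    have hsplit : |(degOneClassCount K C x : ℝ) - offsetLogIntegral x / h| ≤
        |(primeIdealClassCount K C x : ℝ) - offsetLogIntegral x / h| +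
          ((primeIdealClassCount K C x : ℝ) - degOneClassCount K C x) := by
      rw [abs_le]; have := abs_le.1 (le_refl |(primeIdealClassCount K C x : ℝ) - offsetLogIntegral x / h|)
      constructor <;> nlinarith [abs_nonneg ((primeIdealClassCount K C x : ℝ) - offsetLogIntegral x / h),
        neg_abs_le ((primeIdealClassCount K C x : ℝ) - offsetLogIntegral x / h),
        le_abs_self ((primeIdealClassCount K C x : ℝ) - offsetLogIntegral x / h)]
    refine hsplit.trans ?_
    have hdef'' : (primeIdealClassCount K C x : ℝ) - degOneClassCount K C x ≤ E' * (offsetLogIntegral x / h) := by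
      rw [mul_div_assoc', le_div_iff₀ hh0]; linarith
    have hmain : c₃ * E * (offsetLogIntegral x / h) ≤ c₃ * E' * (offsetLogIntegral x / h) :=
      mul_le_mul_of_nonneg_right (mul_le_mul_of_nonneg_left hEE' hc₃.le) (div_nonneg hLi0 hh0.le)
    calc |(primeIdealClassCount K C x : ℝ) - offsetLogIntegral x / h| +
          ((primeIdealClassCount K C x : ℝ) - degOneClassCount K C x)
        ≤ c₃ * E' * (offsetLogIntegral x / h) + E' * (offsetLogIntegral x / h) := add_le_add (h1.trans hmain) hdef''
      _ = (c₃ + 1) * E' * (offsetLogIntegral x / h) := by ring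
  · refine Or.inr ⟨χ₁, β₁, hreal, hwin, hβ1, hL0, fun C x hx ↦
      ⟨by exact_mod_cast degOneClassCount_le K C x, ?_⟩⟩
    obtain ⟨hxc₁, hx256, hx1, hlog, hEE', -⟩ := hrange x hx
    have hx0 : 0 < x := by linarith
    set E : ℝ := ThornerZaman.errorTermN c₂ Q n x with hE
    set E' : ℝ := ThornerZaman.errorTermN (min c₂ 1 / 2) Q n x with hE'
    have hE'0 : 0 < E' := ThornerZaman.errorTermN_pos _ _ _ _
    have h1 := hB C x hxc₁
    -- Stark: `Q^{-s} ≤ c_S Q^{-2} ≤ 1 − β₁`; the main term `G ≥ x Q^{-s}/(4 log x)`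
    have hδ : Q ^ (-s) ≤ 1 - β₁ := (rpow_neg_stark_le hQ12 hcS).trans (heffK χ₁ hreal β₁ hβ1 hL0)
    have hδ1 : Q ^ (-s) ≤ 1 := Real.rpow_le_one_of_one_le_of_nonpos hQ1.le (by linarith)
    have hθ1 : ((χ₁ C : ℂ)).re = 1 ∨ ((χ₁ C : ℂ)).re = -1 := re_classGroupChar_apply hreal C
    have hβhalf : 1 / 2 < β₁ := by
      have h16 : 1 / (8 * Real.log Q) ≤ 1 / 16 := one_div_le_one_div_of_le (by norm_num) (by linarith)
      linarith
    have hG := exceptionalLiMain_ge hθ1 hβhalf hβ1 (Real.rpow_pos_of_pos hQ0 _) hδ1 hδ hx256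
    set G : ℝ := offsetLogIntegral x - ((χ₁ C : ℂ)).re * offsetLogIntegral (x ^ β₁) with hGdef
    have hG0 : 0 ≤ G := le_trans (by have := Real.log_pos (by linarith : (1:ℝ) < x); positivity) hG
    have hdef := degOne_defect_le hn hKn C hs0 hc'1 (by rw [← hQ]; exact hlog) hx1
    rw [← hQ] at hdef
    have hdef' : h * ((primeIdealClassCount K C x : ℝ) - degOneClassCount K C x) ≤ E' * G := by
      refine hdef.trans ?_
      nlinarith [mul_le_mul_of_nonneg_left hG hE'0.le]
    have hsplit : |(degOneClassCount K C x : ℝ) - G / h| ≤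
        |(primeIdealClassCount K C x : ℝ) - G / h| +
          ((primeIdealClassCount K C x : ℝ) - degOneClassCount K C x) := by
      have hmono : (degOneClassCount K C x : ℝ) ≤ primeIdealClassCount K C x := by
        exact_mod_cast degOneClassCount_le K C x
      rw [abs_le]
      constructor <;> nlinarith [neg_abs_le ((primeIdealClassCount K C x : ℝ) - G / h),
        le_abs_self ((primeIdealClassCount K C x : ℝ) - G / h)]
    refine hsplit.trans ?_
    have hdef'' : (primeIdealClassCount K C x : ℝ) - degOneClassCount K C x ≤ E' * (G / h) := by
      rw [mul_div_assoc', le_div_iff₀ hh0]; linarith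
    have hmain : c₃ * E * (G / h) ≤ c₃ * E' * (G / h) :=
      mul_le_mul_of_nonneg_right (mul_le_mul_of_nonneg_left hEE' hc₃.le) (div_nonneg hG0 hh0.le)
    calc |(primeIdealClassCount K C x : ℝ) - G / h| + ((primeIdealClassCount K C x : ℝ) - degOneClassCount K C x)
        ≤ c₃ * E' * (G / h) + E' * (G / h) := add_le_add (h1.trans hmain) hdef''
      _ = (c₃ + 1) * E' * (G / h) := by ring

/-- **Odd degree, degree-one primes, no Landau–Siegel term**: for the number fields of a fixed ODD degree
`n > 1`, `|π¹_C(x) − Li(x)/h| ≤ c₃ E(x) Li(x)/h` for every class `C` and every `x ≥ Q^{c₁}`.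
[cite: ThornerZaman2019, Theorem 1.4] [cite: Stark1974, Theorem 3] -/
theorem degOneClassCount_TZ_of_odd (n : ℕ) (hn : 1 < n) (hodd : Odd n) :
    ∃ c₁ c₂ c₃ : ℝ, 0 < c₁ ∧ 0 < c₂ ∧ 0 < c₃ ∧
    ∀ (K : Type) [Field K] [NumberField K], Module.finrank ℚ K = n →
      ∀ (C : ClassGroup (𝓞 K)) (x : ℝ), ThornerZaman.condQn K ^ c₁ ≤ x →
        (degOneClassCount K C x : ℝ) ≤ primeIdealClassCount K C x ∧
        |(degOneClassCount K C x : ℝ) - offsetLogIntegral x / NumberField.classNumber K| ≤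
          c₃ * ThornerZaman.errorTermN c₂ (ThornerZaman.condQn K) n x *
            (offsetLogIntegral x / NumberField.classNumber K) := by
  classical
  obtain ⟨c₁, c₂, c₃, hc₁, hc₂, hc₃, H⟩ := classPNT_TZ_of_odd n hn hodd
  have hc'1 : min c₂ 1 ≤ 1 := min_le_right _ _
  refine ⟨max c₁ 72, min c₂ 1 / 2, c₃ + 1, by positivity, by positivity, by positivity,
    fun K _ _ hKn C x hx ↦ ⟨by exact_mod_cast degOneClassCount_le K C x, ?_⟩⟩
  have hK : 1 < Module.finrank ℚ K := by rw [hKn]; exact hn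
  set Q : ℝ := ThornerZaman.condQn K with hQ
  have hQ12 : (12 : ℝ) ≤ Q := ThornerZaman.twelve_le_condQn (K := K) hK
  have hQ1 : (1 : ℝ) < Q := by linarith
  have hQ0 : (0 : ℝ) < Q := by linarith
  have hlogQ : 2 ≤ Real.log Q := two_lt_log_twelve.le.trans (Real.log_le_log (by norm_num) hQ12)
  set h : ℝ := (NumberField.classNumber K : ℝ) with hh
  have hh1 : 1 ≤ h := by rw [hh]; exact_mod_cast one_le_classNumber (K := K)
  have hh0 : 0 < h := by linarith
  have hxc₁ : Q ^ c₁ ≤ x := (Real.rpow_le_rpow_of_exponent_le hQ1.le (le_max_left _ _)).trans hx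
  have hx72 : Q ^ (72 : ℝ) ≤ x := (Real.rpow_le_rpow_of_exponent_le hQ1.le (le_max_right _ _)).trans hx
  have hxpos : 0 < x := lt_of_lt_of_le (Real.rpow_pos_of_pos hQ0 _) hx
  have hlog : (72 + 8 * 0) * Real.log Q ≤ Real.log x := by
    rw [mul_zero, add_zero, ← Real.log_rpow hQ0]; exact Real.log_le_log (Real.rpow_pos_of_pos hQ0 _) hx72
  have hx256 : (256 : ℝ) ≤ x := by
    have hl : Real.log 256 ≤ Real.log x := by
      have : Real.log 256 = 8 * Real.log 2 := by
        rw [show (256 : ℝ) = 2 ^ 8 by norm_num, Real.log_pow]; norm_num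
      linarith [Real.log_two_lt_d9]
    exact (Real.log_le_log_iff (by norm_num) hxpos).mp hl
  have hx1 : (1 : ℝ) ≤ x := by linarith
  set E : ℝ := ThornerZaman.errorTermN c₂ Q n x with hE
  set E' : ℝ := ThornerZaman.errorTermN (min c₂ 1 / 2) Q n x with hE'
  have hE'0 : 0 < E' := ThornerZaman.errorTermN_pos _ _ _ _
  have hEE' : E ≤ E' := ThornerZaman.errorTermN_le_of_le (by have := min_le_left c₂ 1; linarith) hQ1 n hx1
  have h1 := H K hKn C x hxc₁
  have hdef := degOne_defect_le hn hKn C (s := 0) le_rfl hc'1 (by rw [← hQ]; exact hlog) hx1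
  rw [← hQ, Real.rpow_neg hQ0.le, Real.rpow_zero, inv_one, mul_one] at hdef
  have hLi : x / (2 * Real.log x) ≤ offsetLogIntegral x := div_two_mul_log_le_offsetLogIntegral hx256
  have hLx : 0 < Real.log x := Real.log_pos (by linarith)
  have hLi0 : 0 ≤ offsetLogIntegral x := le_trans (by positivity) hLi
  have hdef' : h * ((primeIdealClassCount K C x : ℝ) - degOneClassCount K C x) ≤ E' * offsetLogIntegral x := by
    refine hdef.trans ?_
    have : x / (4 * Real.log x) ≤ offsetLogIntegral x := by
      refine le_trans ?_ hLi
      rw [div_le_div_iff₀ (by positivity) (by positivity)]; nlinarith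
    nlinarith [mul_le_mul_of_nonneg_left this hE'0.le]
  have hmono : (degOneClassCount K C x : ℝ) ≤ primeIdealClassCount K C x := by
    exact_mod_cast degOneClassCount_le K C x
  have hsplit : |(degOneClassCount K C x : ℝ) - offsetLogIntegral x / h| ≤
      |(primeIdealClassCount K C x : ℝ) - offsetLogIntegral x / h| +
        ((primeIdealClassCount K C x : ℝ) - degOneClassCount K C x) := by
    rw [abs_le]
    constructor <;> nlinarith [neg_abs_le ((primeIdealClassCount K C x : ℝ) - offsetLogIntegral x / h),
      le_abs_self ((primeIdealClassCount K C x : ℝ) - offsetLogIntegral x / h)]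
  refine hsplit.trans ?_
  have hdef'' : (primeIdealClassCount K C x : ℝ) - degOneClassCount K C x ≤ E' * (offsetLogIntegral x / h) := by
    rw [mul_div_assoc', le_div_iff₀ hh0]; linarith
  have hmain : c₃ * E * (offsetLogIntegral x / h) ≤ c₃ * E' * (offsetLogIntegral x / h) :=
    mul_le_mul_of_nonneg_right (mul_le_mul_of_nonneg_left hEE' hc₃.le) (div_nonneg hLi0 hh0.le)
  calc |(primeIdealClassCount K C x : ℝ) - offsetLogIntegral x / h| +
        ((primeIdealClassCount K C x : ℝ) - degOneClassCount K C x)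
      ≤ c₃ * E' * (offsetLogIntegral x / h) + E' * (offsetLogIntegral x / h) := add_le_add (h1.trans hmain) hdef''
    _ = (c₃ + 1) * E' * (offsetLogIntegral x / h) := by ring

/-- **Every cubic field, degree-one primes**: `|π¹_C(x) − Li(x)/h_K| ≤ c₃ E(x) Li(x)/h_K` for every class
`C` and every `x ≥ (27|d_K|)^{c₁}` — the split/degree-one primes the quantum class-group algorithm samples
are equidistributed among the classes with decaying relative error and no Landau–Siegel term.
[cite: ThornerZaman2019, Theorem 1.4] [cite: Stark1974, Theorem 3] -/
theorem degOneClassCount_TZ_cubic :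
    ∃ c₁ c₂ c₃ : ℝ, 0 < c₁ ∧ 0 < c₂ ∧ 0 < c₃ ∧
    ∀ (K : Type) [Field K] [NumberField K], Module.finrank ℚ K = 3 →
      ∀ (C : ClassGroup (𝓞 K)) (x : ℝ), ThornerZaman.condQn K ^ c₁ ≤ x →
        (degOneClassCount K C x : ℝ) ≤ primeIdealClassCount K C x ∧
        |(degOneClassCount K C x : ℝ) - offsetLogIntegral x / NumberField.classNumber K| ≤
          c₃ * ThornerZaman.errorTermN c₂ (ThornerZaman.condQn K) 3 x *
            (offsetLogIntegral x / NumberField.classNumber K) :=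
  degOneClassCount_TZ_of_odd 3 (by norm_num) (by decide)

end Summit.QuantumAdvantage.QuantumAdvantage.Theorems.DegreeOnePrimesEscape

end
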